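import Summits.HodgeConjecture.HodgeConjecture.Theorems.K2E5QuatZetaAbsConvOfThetaTail   -- ★ (γ) (p855831): `quatZeta_integrable_of_thetaTail` ((H2) discharged by ★ G1′; (α) p855593, (β) p855681 ∕ p855790 below it)
import Summits.HodgeConjecture.HodgeConjecture.Theorems.K2E5QuatThetaBounds              -- ★ (K2E5-p01 (g2)): `thetaTail_le_exp` — theta sums over `Γ_h` along the central ray, every rate `κ > 1`
import HarnessLib

/-!
# K2 ∕ E5 «TamagawaUnitary» — tier-2 file `K2E5QuatZetaAbsConv`: ABSOLUTE CONVERGENCE OF THE QUATERNIONIC ZETA INTEGRAL `Z(Φ, s)` ON `(D_h ⊗ 𝔸)^×` FOR `re s = σ > 1`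

Track B «K2-LIT», engine E5, crux H413 (`stmt-HodgeConjecture-24833`); seat K2E5-p07 (g0); deal (g) of BATCH #8 (K2E5-plan (g0) 2026-09-03T23:12Z; RULING (A)(2) K2E5-plan (g2)
23:30:59Z), the by-name file.  For a CM field `L`, a hermitian ANISOTROPIC non-degenerate plane `h`, a test function `Φ ∈ 𝒮(M₂(𝔸_L))` adapted to the rational basis of `D_h`
(★ #3g `quatSchwartzBruhat`), a real `σ > 1`, and a pair of Haar-type measures `dx` on `(D_h ⊗ 𝔸)^×` (★ #3g `quatAdelicUnits`) and `dx¹` on the module-one subgroup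
`D^{(1)}_{h,𝔸}` (★ #3j `quatAdelicUnitsOne`) tied by TATE'S DISINTEGRATION `dx = dx¹ ⊗ dt` along the central section `θ_{e^t}` (hypothesis `hdis` — verbatim the hypothesis
of socket G3 `sig_K2E5QuatZetaUnfolding`, the only input carried): the integrand `Φ(x) |det x|_𝔸^σ` of ★ #3g `quatZeta L h dx Φ σ` is `dx`-INTEGRABLE —
`quatZetaAbsConv`; and so is its real majorant `‖Φ(x)‖ |det x|_𝔸^σ` — `quatZeta_majorant_integrable`.

Assembly (all ★, kernel-checked, axioms ⊆ the trio): (α) ★ `K2E5QuatZetaAbsConvReduction` (continuity ∕ measurability, integrand ⟺ majorant); (β) ★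
`K2E5QuatZetaAbsConvOfThetaBounds(Rates)` (disintegration → `|det(yθ_t)| = e^t` → Weil's constant-one unfolding over `Γ_h` (★ A7 `fiberLIntegral_count_mk`, ★
`lintegral_fiberLIntegral_quotientMeasure`) → `Γ_h`-periodicity + compact covering set → two-rate Tate profile `e^{(σ−κ₁)t}1_{t≤0} + e^{(σ−κ₂)t}1_{t>0}`, `κ₁ := (1+σ)/2`,
`κ₂ := σ+1`); (γ) ★ `K2E5QuatZetaAbsConvOfThetaTail` (finite covolume + compact covering set from FUJISAKI ★ G1′ `K2E5QuatUnitsOneCocompact.quatUnitsOneCocompact`, K2E5-p03);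
(H3) ★ `K2E5QuatThetaBounds.thetaTail_le_exp` (K2E5-p01: theta sums over `Γ_h` along the ray at every rate `κ > 1`, over ★ `AdelicThetaTailRayDecay` and K2E5-p14's ★
`K2E5QuatPoissonTransport`).  No `sorry`, no `instance`, no `notation`.

HONEST LABEL: HC_CM is proved only modulo the 7 printed citations (2 remaining named inputs: hLiu418 = stmt-HodgeConjecture-24832, h413 = stmt-HodgeConjecture-24833) until rung 0
closes; this file is a helper (`--supports stmt-HodgeConjecture-24833 --as helper`) and changes no count.

## References
[WeilBNT1967] A. Weil, *Basic Number Theory* (1967), Ch. IV §3 Thm. 4, Ch. VII §5 Prop. 11 · [TateThesis1967] J. Tate, in Cassels–Fröhlich (1967), Ch. XV §4.4 ·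
[VignerasLNM800] M.-F. Vignéras, LNM 800 (1980), Ch. III §2 Thm. 2.2 · [GodementJacquetLNM260] R. Godement, H. Jacquet, LNM 260 (1972), §11.
-/

set_option autoImplicit false
set_option linter.dupNamespace false

noncomputable section

namespace Summit.HodgeConjecture.HodgeConjecture.Cruxes.H413.K2E5QuatZetaAbsConv

open NumberField IsDedekindDomain MeasureTheory MeasureTheory.Measure Filter Topology Set
open scoped Matrix MatrixGroups NNReal ENNReal
open Literature.MeasureTheory.Group Literature.NumberTheory Literature.NumberTheory.Automorphic
open Literature.AlgebraicGeometry.ShimuraVarieties (hermForm)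
open Summit.HodgeConjecture.HodgeConjecture.Cruxes.H413.K2E5QuatAdelicMatrixModel
open Summit.HodgeConjecture.HodgeConjecture.Cruxes.H413.K2E5QuatZeta
open Summit.HodgeConjecture.HodgeConjecture.Cruxes.H413.K2E5QuatAdelicLattice
open Summit.HodgeConjecture.HodgeConjecture.Cruxes.H413.K2E5QuatAdelicModuleOne
open Summit.HodgeConjecture.HodgeConjecture.Cruxes.H413.K2E5QuatZetaAbsConvOfThetaBounds

section Main

set_option synthInstance.maxHeartbeats 400000
set_option maxHeartbeats 1600000

variable (L : Type) [Field L] [NumberField L] [IsCMField L] {Ha : Matrix (Fin 2) (Fin 2) L}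
  (hHa : (Ha.map (cmConjRingHom L)).transpose = Ha) (hdet : Ha.det ≠ 0)
  [MeasurableSpace (GL (Fin 2) (AdeleRing (𝓞 L) L))] [BorelSpace (GL (Fin 2) (AdeleRing (𝓞 L) L))]
  [MeasurableSpace (↥(quatAdelicUnitsOne L Ha) ⧸ quatRatLatticeOne L Ha)] [BorelSpace (↥(quatAdelicUnitsOne L Ha) ⧸ quatRatLatticeOne L Ha)]
  [LocallyCompactSpace ↥(quatAdelicUnitsOne L Ha)] [SecondCountableTopology ↥(quatAdelicUnitsOne L Ha)] [T2Space ↥(quatAdelicUnitsOne L Ha)]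

/-- **THE MAJORANT IS INTEGRABLE** (`σ > 1`): `∫_{(D_h ⊗ 𝔸)^×} ‖Φ(x)‖ |det x|_𝔸^σ dx < ∞` for `h` hermitian anisotropic non-degenerate, `Φ ∈ 𝒮`, and `(dx, dx¹)` tied by Tate's
disintegration `hdis` (socket G3's hypothesis).  ★ (γ) `quatZeta_majorant_integrable_of_thetaTail` fed with ★ `K2E5QuatThetaBounds.thetaTail_le_exp`.
[cite: WeilBNT1967, Ch. VII §5 Prop. 11] [cite: TateThesis1967, §4.4] [cite: VignerasLNM800, Ch. III §2 Thm. 2.2] -/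
theorem quatZeta_majorant_integrable (hanis : ∀ x : Fin 2 → L, hermForm (cmConjRingHom L) Ha x x = 0 → x = 0)
    (dx : Measure ↥(quatAdelicUnits L Ha))
    (dx1 : Measure ↥(quatAdelicUnitsOne L Ha)) [dx1.IsHaarMeasure] [dx1.IsMulRightInvariant]
    [(count : Measure ↥(quatRatLatticeOne L Ha)).IsHaarMeasure]
    -- (H1) Tate's disintegration `dx = dx¹ ⊗ dt` (verbatim the hypothesis of socket G3)
    (hdis : ∀ f : ↥(quatAdelicUnits L Ha) → ℝ≥0∞, Measurable f →
      ∫⁻ x, f x ∂dx = ∫⁻ t : ℝ, ∫⁻ y, f ((y : ↥(quatAdelicUnits L Ha)) *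
        quatModuleSection L Ha (Units.mk0 (Real.toNNReal (Real.exp t)) (Real.toNNReal_pos.2 (Real.exp_pos t)).ne')) ∂dx1)
    {Φ : Matrix (Fin 2) (Fin 2) (AdeleRing (𝓞 L) L) → ℂ}
    (hΦ : Φ ∈ quatSchwartzBruhat L (fun i => ((quatBasis L Ha hHa hdet i : ↥(quatRatSubalgebra L Ha)) : Matrix (Fin 2) (Fin 2) L)))
    {σ : ℝ} (hσ : 1 < σ) :
    Integrable (fun x : ↥(quatAdelicUnits L Ha) =>
      ‖Φ ((x : GL (Fin 2) (AdeleRing (𝓞 L) L)) : Matrix (Fin 2) (Fin 2) (AdeleRing (𝓞 L) L))‖ * ((quatModule L Ha x : ℝ≥0) : ℝ) ^ σ) dx :=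
  quatZeta_majorant_integrable_of_thetaTail L hHa hdet hanis dx dx1 hdis hΦ hσ
    fun _ hK _ hκ => K2E5QuatThetaBounds.thetaTail_le_exp L hHa hdet hK hΦ hκ

/-- **`quatZetaAbsConv` — ABSOLUTE CONVERGENCE OF `Z(Φ, s)` AT THE REAL POINT `s = σ > 1`** (deal (g)): the integrand `Φ(x) |det x|_𝔸^s` of ★ #3g `quatZeta L h dx Φ s` is
`dx`-integrable on `(D_h ⊗ 𝔸)^×`, for `h` hermitian anisotropic non-degenerate, `Φ ∈ 𝒮`, and `(dx, dx¹)` tied by Tate's disintegration `hdis` (socket G3's hypothesis).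
[cite: WeilBNT1967, Ch. VII §5 Prop. 11] [cite: TateThesis1967, §4.4] [cite: VignerasLNM800, Ch. III §2 Thm. 2.2] -/
theorem quatZetaAbsConv (hanis : ∀ x : Fin 2 → L, hermForm (cmConjRingHom L) Ha x x = 0 → x = 0)
    (dx : Measure ↥(quatAdelicUnits L Ha))
    (dx1 : Measure ↥(quatAdelicUnitsOne L Ha)) [dx1.IsHaarMeasure] [dx1.IsMulRightInvariant]
    [(count : Measure ↥(quatRatLatticeOne L Ha)).IsHaarMeasure]
    (hdis : ∀ f : ↥(quatAdelicUnits L Ha) → ℝ≥0∞, Measurable f →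
      ∫⁻ x, f x ∂dx = ∫⁻ t : ℝ, ∫⁻ y, f ((y : ↥(quatAdelicUnits L Ha)) *
        quatModuleSection L Ha (Units.mk0 (Real.toNNReal (Real.exp t)) (Real.toNNReal_pos.2 (Real.exp_pos t)).ne')) ∂dx1)
    {Φ : Matrix (Fin 2) (Fin 2) (AdeleRing (𝓞 L) L) → ℂ}
    (hΦ : Φ ∈ quatSchwartzBruhat L (fun i => ((quatBasis L Ha hHa hdet i : ↥(quatRatSubalgebra L Ha)) : Matrix (Fin 2) (Fin 2) L)))
    {σ : ℝ} (hσ : 1 < σ) :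
    Integrable (fun x : ↥(quatAdelicUnits L Ha) =>
      Φ ((x : GL (Fin 2) (AdeleRing (𝓞 L) L)) : Matrix (Fin 2) (Fin 2) (AdeleRing (𝓞 L) L)) * (((quatModule L Ha x : ℝ≥0) : ℝ) : ℂ) ^ (σ : ℂ)) dx :=
  quatZeta_integrable_of_thetaTail L hHa hdet hanis dx dx1 hdis hΦ hσ
    fun _ hK _ hκ => K2E5QuatThetaBounds.thetaTail_le_exp L hHa hdet hK hΦ hκ

end Main

end Summit.HodgeConjecture.HodgeConjecture.Cruxes.H413.K2E5QuatZetaAbsConv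

end
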